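import Literature.AlgebraicGeometry.HodgeTheory.DworkFamilyComplexPoints
import Literature.AlgebraicGeometry.Motives.FiniteQuotient
import Literature.AlgebraicGeometry.Motives.RationallyChainConnected
import Literature.AlgebraicGeometry.HodgeTheory.FivefoldChowZeroDegenerateHodgeConjecture
import Literature.AlgebraicGeometry.HodgeTheory.AlgebraicClassesPullback
import HarnessLib

/-!
# The coordinate reflections of the Dwork sextic as scheme automorphisms, the quotient fourfold
# `X_ψ/⟨s⟩`, and Bini–Garbagnati's theorem that it is a smooth Fano (hence rationally connected)
# fourfold (Bini–Garbagnati, *Quotients of the Dwork pencil*, Prop. 3.20)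

Family `hodge`, layer `Literature/AlgebraicGeometry/HodgeTheory` (namespace `DworkSextic` of
`DworkSexticEigenspaces` / `DworkFamilyComplexPoints`). Cite item `wi-73355` of the cell `hodge-nonav`
(route `DworkReflectionQuotients`, crux `ReflectionQuotientDescent` = stmt-HodgeConjecture-20240), stated
on the interface `Motives.finiteQuotient` (`Motives/FiniteQuotient`, item `defn-finiteQuotient`).

For the Dwork sextic `X_ψ : Σ_l x_l⁶ − 6ψ ∏_l x_l = 0 ⊂ ℙ⁵_ℂ` (`DworkSextic.fibre ψ`), `i ≠ j` and
`ζ⁶ = 1`, the coordinate reflection `s_(i,j,ζ) : x_i ↦ ζ x_j, x_j ↦ ζ⁻¹ x_i, x_l ↦ x_l` preserves the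
form, hence (the tree's `SmoothHypersurface.substLiftIso`, restriction of a projective linear
transformation to the reduced hypersurface) is a `ℂ`-automorphism of `X_ψ`:

* §1 `reflCoeff`, `reflSubst` (the linear substitution, `x_l ↦ c_l · x_{(ij)l}`), its homogeneity,
  involutivity (`aeval_reflSubst_reflSubst`) and the invariance `aeval_reflSubst_form`;
  `substVec_reflSubst` — on coordinate vectors it is literally the `IsRefl i j ζ` formula of the
  route's cruxes;
* §2 `reflIso ψ i j ζ : fibre ψ ≅ fibre ψ`, self-inverse (`reflIso_hom_comp_reflIso_hom`), compatible
  with `X_ψ ↪ ℙ⁵`; the order-two action `reflAction ψ i j ζ : ActionOver (fibre ψ).hom (Multiplicative (ZMod 2))`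
  (via the general `ActionOver.ofInvolution`); its action on complex points IS a realisation of the
  reflection in homogeneous coordinates (`exists_rep_pt_reflIso`, `exists_rep_pt_pointsAction_reflAction`)
  and every continuous self-map of `X_ψ(ℂ)` realising `s_(i,j,ζ)` equals it (`eq_pointsAction_of_isRefl`,
  injectivity of `pt`) — so the `g` quantified over in `ReflectionQuotientDescent` is
  `pointsAction (reflAction ψ i j ζ) s` and `g^* c = c` is invariance under the group;
* §3 the quotient `X_ψ/⟨s⟩ := Motives.finiteQuotient (reflAction ψ i j ζ …)` with its quotient map
  `reflQuotientMap` (Mumford's cover hypothesis discharged by projectivity of `X_ψ`,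
  `reflCover`), and
* §4 the NAMED FACT `BiniGarbagnati2012_reflectionQuotient_smoothProjective_rcc` (Bini–Garbagnati,
  Prop. 3.20: for `n + 1 = 6` even and `ψ⁶ ≠ 1` the quotient is a smooth Fano fourfold — rendered as
  «smooth projective of dimension 4 and rationally chain connected», Fano ⟹ rationally connected being
  Kollár–Miyaoka–Mori 1992 Thm. 0.1 / Campana 1992; the tree has no anticanonical/Fano vocabulary on
  `SchemeOver`, and RCC is exactly what the consumer needs:
  `IsRationallyChainConnected.hasChowZeroSupportedInDimLE_zero` ⟹
  `hodgeConjectureFor_four_of_hasChowZeroSupportedInDimLE` with `d = 0`), with its unpacking lemmas;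
* §5 the consequences GRANTED the named facts (all proved here from them): the reflections are
  realised for every `ψ` (`exists_continuousMap_isRefl`); for `ψ⁶ ≠ 1` the Hodge conjecture holds for
  `X_ψ/⟨s⟩` (`hodgeConjectureFor_reflQuotient`, from B–G); reflection-invariant rational
  `(p, q)`-classes descend to rational `(p, q)`-classes on `X_ψ/⟨s⟩`
  (`exists_rational_hodge_map_reflQuotientMap_eq`, from Bredon's transfer + B–G, through
  `Motives.exists_rational_hodge_map_mk_eq`); and reflection-invariant rational `(2,2)`-classes on
  `X_ψ` are algebraic (`mem_algebraicClasses_of_isRefl_invariant`, from the three facts: transfer,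
  B–G, Fulton's pull-back of algebraic classes).

Bini–Garbagnati print the statement for the transposition `τ = (12)` ("We may assume that `τ` is the
transposition `(12)`", §3.4): every `s_(i,j,ζ)` is conjugate to `τ_(ij)` by the diagonal automorphism
`diag(ζ at i, ζ⁻¹ at some k ∉ {i,j})` of `X_ψ` (an element of Katz's `Γ_W`, `DworkSextic.diagIso`), and
to `(12)` by a coordinate permutation, so the 90 quotients `X_ψ/⟨s_(i,j,ζ)⟩` are pairwise isomorphic;
the fact is stated for all of them (this is the reading recorded in the item `wi-73355`).

Everything except §4 is a definition with a body or a theorem (0 sorries); §4 is ONE named fact with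
its cite (a published, refereed theorem: J. Geom. Phys. 75 (2014); arXiv:1207.7175 p. 17 read).

## References

* [BiniGarbagnati2012] G. Bini, A. Garbagnati, *Quotients of the Dwork pencil*, J. Geom. Phys. 75
  (2014) 173–198 = arXiv:1207.7175, §3.4 and Prop. 3.20 (p. 17 of the arXiv text).
* [KollarMiyaokaMori1992] J. Kollár, Y. Miyaoka, S. Mori, *Rational connectedness and boundedness of
  Fano manifolds*, J. Differential Geom. 36 (1992), Thm. 0.1.
* [Kollar1995] J. Kollár, *Shafarevich maps and automorphic forms* (1995), Def. 4.10 (RCC).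
* [Katz2009] N. M. Katz, *Another look at the Dwork family* (2009), §2–§3.
* [Hartshorne1977] R. Hartshorne, *Algebraic Geometry*, II Ex. 2.14, II Ex. 3.11 (d), II 7.1.1.
* [Bredon1997] G. E. Bredon, *Sheaf Theory* (2nd ed., 1997), II Thm. 19.2 (finite-quotient transfer).
* [Fulton1998] W. Fulton, *Intersection Theory* (2nd ed., 1998), §19.2 Cor. 19.2 (b).
* [BlochSrinivas1983] S. Bloch, V. Srinivas, *Remarks on correspondences and algebraic cycles*,
  Amer. J. Math. 105 (1983), Thm. 1 (3).
-/

noncomputable section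

open CategoryTheory AlgebraicGeometry MvPolynomial
open scoped LinearAlgebra.Projectivization
open Literature.AlgebraicGeometry.Motives Literature.AlgebraicGeometry.RelativeSpec

universe u

/-! ### §0 A general constructor: the action of `ℤ/2` given by an involution of a `k`-scheme -/

namespace Literature.AlgebraicGeometry.RelativeSpec.ActionOver

variable {k : Type u} [Field k] {X : SchemeOver k}

/-- The underlying automorphism of schemes of a `k`-isomorphism `e : X ≅ X`, as an element of
`Aut X.left`. [cite: MumfordAV1970, §7 Thm. p. 66] -/
def autLeft (e : X ≅ X) : Aut X.left := (Over.forget _).mapIso e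

/-- `(autLeft e).hom = e.hom.left`. [cite: MumfordAV1970, §7 Thm. p. 66] -/
@[simp]
theorem autLeft_hom (e : X ≅ X) : (autLeft e).hom = e.hom.left := rfl

/-- The two elements of `ℤ/2` (multiplicative notation): the identity and the "order two element"
`τ`. [cite: BiniGarbagnati2012, §3.4] -/
theorem eq_one_or_eq_gen (g : Multiplicative (ZMod 2)) :
    g = 1 ∨ g = Multiplicative.ofAdd 1 := by
  revert g; decide

/-- The generator of `ℤ/2` is not the identity. [cite: BiniGarbagnati2012, §3.4] -/
theorem gen_ne_one : (Multiplicative.ofAdd 1 : Multiplicative (ZMod 2)) ≠ 1 := by decide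

/-- The generator of `ℤ/2` squares to the identity ("order two"). [cite: BiniGarbagnati2012, §3.4] -/
theorem gen_mul_gen :
    (Multiplicative.ofAdd 1 : Multiplicative (ZMod 2)) * Multiplicative.ofAdd 1 = 1 := by decide

/-- **The action of `ℤ/2` on a `k`-scheme defined by a `k`-involution `e`** (`e ≫ e = 𝟙`): the
non-trivial element acts by `e` (Bini–Garbagnati §3.4: "`τ` … is an order two element"; the finite
group of the quotient `X/⟨τ⟩`). [cite: BiniGarbagnati2012, §3.4] -/
def ofInvolution (e : X ≅ X) (he : e.hom ≫ e.hom = 𝟙 X) : ActionOver X.hom (Multiplicative (ZMod 2)) where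
  aut :=
    { toFun := fun g => if g = 1 then 1 else autLeft e
      map_one' := by simp
      map_mul' := by
        have hee : autLeft e * autLeft e = 1 := by
          ext : 1
          rw [Aut.Aut_mul_def, Iso.trans_hom, autLeft_hom, ← Over.comp_left, he]
          rfl
        intro a b
        rcases eq_one_or_eq_gen a with rfl | rfl <;> rcases eq_one_or_eq_gen b with rfl | rfl
        · simp
        · simp
        · simp
        · simp [gen_mul_gen, hee] }
  aut_comp g := by
    by_cases hg : g = 1
    · subst hg
      simp only [MonoidHom.coe_mk, OneHom.coe_mk]
      exact Category.id_comp _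
    · simp only [MonoidHom.coe_mk, OneHom.coe_mk, hg, ↓reduceIte, autLeft_hom]
      exact Over.w e.hom

/-- The trivial element acts trivially. [cite: BiniGarbagnati2012, §3.4] -/
theorem ofInvolution_aut_one (e : X ≅ X) (he : e.hom ≫ e.hom = 𝟙 X) :
    (ofInvolution e he).aut 1 = 1 := by
  simp [ofInvolution]

/-- The non-trivial element of `ℤ/2` acts by `e`. [cite: BiniGarbagnati2012, §3.4] -/
theorem ofInvolution_aut_of_ne_one (e : X ≅ X) (he : e.hom ≫ e.hom = 𝟙 X)
    {g : Multiplicative (ZMod 2)} (hg : g ≠ 1) : (ofInvolution e he).aut g = autLeft e := by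
  simp [ofInvolution, hg]

/-- The overlying `k`-isomorphism of the non-trivial element is `e`. [cite: BiniGarbagnati2012, §3.4] -/
theorem overIso_ofInvolution_hom_of_ne_one (e : X ≅ X) (he : e.hom ≫ e.hom = 𝟙 X)
    {g : Multiplicative (ZMod 2)} (hg : g ≠ 1) : ((ofInvolution e he).overIso g).hom = e.hom := by
  ext : 1
  rw [overIso_hom_left, ofInvolution_aut_of_ne_one e he hg, autLeft_hom]

/-- The overlying `k`-isomorphism of the trivial element is the identity. [cite: BiniGarbagnati2012, §3.4] -/
theorem overIso_ofInvolution_hom_one (e : X ≅ X) (he : e.hom ≫ e.hom = 𝟙 X) :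
    ((ofInvolution e he).overIso 1).hom = 𝟙 X :=
  overIso_one_hom _

end Literature.AlgebraicGeometry.RelativeSpec.ActionOver

namespace Literature.AlgebraicGeometry.HodgeTheory.DworkSextic

/-! ### §1 The reflection substitution `s_(i,j,ζ)` -/

section Subst

variable (i j : Fin 6) (ζ : ℂ)

/-- The scalar of the reflection substitution at the variable `x_l`: `ζ` at `l = i`, `ζ⁻¹` at `l = j`,
`1` elsewhere (written as a product of two indicators, for `i ≠ j`). [cite: BiniGarbagnati2012, §3.4] -/
def reflCoeff (l : Fin 6) : ℂ :=
  (if l = i then ζ else 1) * (if l = j then ζ⁻¹ else 1)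

/-- **The coordinate reflection `s_(i,j,ζ)` as a substitution by linear forms**:
`x_l ↦ reflCoeff l · x_{(i j) l}`, i.e. `x_i ↦ ζ x_j`, `x_j ↦ ζ⁻¹ x_i`, `x_l ↦ x_l` (`l ≠ i, j`).
[cite: BiniGarbagnati2012, §3.4] -/
def reflSubst : Fin 6 → MvPolynomial (Fin 6) ℂ :=
  fun l => C (reflCoeff i j ζ l) * X (Equiv.swap i j l)

/-- The substitution is by linear forms. [cite: Hartshorne1977, II Ex. 2.14] -/
theorem isHomogeneous_reflSubst : ∀ l, (reflSubst i j ζ l).IsHomogeneous 1 := fun _ =>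
  isHomogeneous_C_mul_X _ _

variable {i j ζ}

/-- `reflCoeff` at `i`. [cite: BiniGarbagnati2012, §3.4] -/
theorem reflCoeff_left (hij : i ≠ j) : reflCoeff i j ζ i = ζ := by
  simp [reflCoeff, hij]

/-- `reflCoeff` at `j`. [cite: BiniGarbagnati2012, §3.4] -/
theorem reflCoeff_right (hij : i ≠ j) : reflCoeff i j ζ j = ζ⁻¹ := by
  simp [reflCoeff, Ne.symm hij]

/-- `reflCoeff` elsewhere. [cite: BiniGarbagnati2012, §3.4] -/
theorem reflCoeff_of_ne {l : Fin 6} (hi : l ≠ i) (hj : l ≠ j) : reflCoeff i j ζ l = 1 := by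
  simp [reflCoeff, hi, hj]

/-- `c_l · c_{(ij) l} = 1` (`ζ ≠ 0`): the substitution is an involution. [cite: BiniGarbagnati2012, §3.4] -/
theorem reflCoeff_mul_reflCoeff_swap (hij : i ≠ j) (hζ : ζ ≠ 0) (l : Fin 6) :
    reflCoeff i j ζ l * reflCoeff i j ζ (Equiv.swap i j l) = 1 := by
  by_cases hi : l = i
  · subst hi
    rw [Equiv.swap_apply_left, reflCoeff_left hij, reflCoeff_right hij, mul_inv_cancel₀ hζ]
  · by_cases hj : l = j
    · subst hj
      rw [Equiv.swap_apply_right, reflCoeff_right hij, reflCoeff_left hij, inv_mul_cancel₀ hζ]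
    · rw [Equiv.swap_apply_of_ne_of_ne hi hj, reflCoeff_of_ne hi hj, one_mul]

/-- `c_l⁶ = 1` when `ζ⁶ = 1`. [cite: BiniGarbagnati2012, §3.4] -/
theorem reflCoeff_pow_six (hζ : ζ ^ 6 = 1) (l : Fin 6) : reflCoeff i j ζ l ^ 6 = 1 := by
  unfold reflCoeff
  split_ifs <;> simp [mul_pow, inv_pow, hζ]

/-- `∏_l c_l = 1` (`i ≠ j`, `ζ ≠ 0`). [cite: BiniGarbagnati2012, §3.4] -/
theorem prod_reflCoeff (hζ : ζ ≠ 0) : ∏ l, reflCoeff i j ζ l = 1 := by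
  unfold reflCoeff
  rw [Finset.prod_mul_distrib, Finset.prod_ite_eq', Finset.prod_ite_eq']
  simp [mul_inv_cancel₀ hζ]

/-- `s(x_l) = c_l x_{(ij)l}` under `aeval`. [cite: Hartshorne1977, II Ex. 2.14] -/
theorem aeval_reflSubst_X (l : Fin 6) :
    aeval (reflSubst i j ζ) (X l : MvPolynomial (Fin 6) ℂ) = C (reflCoeff i j ζ l) * X (Equiv.swap i j l) := by
  rw [aeval_X]; rfl

/-- **`s_(i,j,ζ)` is an involution on polynomials** (`ζ ≠ 0`). [cite: BiniGarbagnati2012, §3.4] -/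
theorem aeval_reflSubst_reflSubst (hij : i ≠ j) (hζ : ζ ≠ 0) (p : MvPolynomial (Fin 6) ℂ) :
    aeval (reflSubst i j ζ) (aeval (reflSubst i j ζ) p) = p := by
  have key : (aeval (reflSubst i j ζ)).comp (aeval (reflSubst i j ζ)) =
      AlgHom.id ℂ (MvPolynomial (Fin 6) ℂ) := by
    refine MvPolynomial.algHom_ext fun l => ?_
    rw [AlgHom.comp_apply, AlgHom.id_apply, aeval_reflSubst_X, map_mul, aeval_C, aeval_reflSubst_X,
      ← mul_assoc, Equiv.swap_apply_self, algebraMap_eq, ← map_mul, reflCoeff_mul_reflCoeff_swap hij hζ,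
      map_one, one_mul]
  exact congrArg (fun φ : MvPolynomial (Fin 6) ℂ →ₐ[ℂ] MvPolynomial (Fin 6) ℂ => φ p) key

/-- **The Dwork sextic form is invariant under `s_(i,j,ζ)`** (`ζ⁶ = 1`; `i ≠ j` is not needed): `Σ x_l⁶` is
permuted (`(c_l x_{(ij)l})⁶ = x_{(ij)l}⁶`) and `∏ x_l` is multiplied by `∏ c_l = ζ ζ⁻¹ = 1`.
[cite: BiniGarbagnati2012, §3.4] -/
theorem aeval_reflSubst_form (ψ : ℂ) (hζ : ζ ^ 6 = 1) :
    aeval (reflSubst i j ζ) (form ψ) = form ψ := by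
  have hζ0 : ζ ≠ 0 := by
    rintro rfl
    norm_num at hζ
  have h6 : ∀ l, aeval (reflSubst i j ζ) (X l ^ 6 : MvPolynomial (Fin 6) ℂ) = X (Equiv.swap i j l) ^ 6 := by
    intro l
    rw [map_pow, aeval_reflSubst_X, mul_pow, ← map_pow, reflCoeff_pow_six hζ, map_one, one_mul]
  have hsum : aeval (reflSubst i j ζ) (∑ l, X l ^ 6 : MvPolynomial (Fin 6) ℂ) = ∑ l, X l ^ 6 := by
    rw [map_sum]
    simp_rw [h6]
    exact Equiv.sum_comp (Equiv.swap i j) (fun l => (X l : MvPolynomial (Fin 6) ℂ) ^ 6)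
  have hprod : aeval (reflSubst i j ζ) (∏ l, X l : MvPolynomial (Fin 6) ℂ) = ∏ l, X l := by
    rw [map_prod]
    simp_rw [aeval_reflSubst_X]
    rw [Finset.prod_mul_distrib, ← map_prod, prod_reflCoeff hζ0, map_one, one_mul]
    exact Equiv.prod_comp (Equiv.swap i j) (fun l => (X l : MvPolynomial (Fin 6) ℂ))
  change aeval (reflSubst i j ζ) ((∑ l, X l ^ 6) - C (6 * ψ) * ∏ l, X l) = (∑ l, X l ^ 6) - C (6 * ψ) * ∏ l, X l
  rw [map_sub, map_mul, aeval_C, algebraMap_eq, hsum, hprod]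

/-- **On coordinate vectors `s_(i,j,ζ)` is the route's `IsRefl i j ζ` formula**:
`(s z)_k = ζ z_j` (`k = i`), `ζ⁻¹ z_i` (`k = j`), `z_k` otherwise. [cite: BiniGarbagnati2012, §3.4] -/
theorem substVec_reflSubst (hij : i ≠ j) (z : Fin 6 → ℂ) :
    ProjectiveSpace.substVec (reflSubst i j ζ) z =
      fun k => if k = i then ζ * z j else if k = j then ζ⁻¹ * z i else z k := by
  funext k
  rw [ProjectiveSpace.substVec_apply, reflSubst, map_mul, aeval_C, aeval_X, Algebra.algebraMap_self,
    RingHom.id_apply]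
  by_cases hi : k = i
  · subst hi
    rw [reflCoeff_left hij, Equiv.swap_apply_left, if_pos rfl]
  · by_cases hj : k = j
    · subst hj
      rw [reflCoeff_right hij, Equiv.swap_apply_right, if_neg hi, if_pos rfl]
    · rw [reflCoeff_of_ne hi hj, Equiv.swap_apply_of_ne_of_ne hi hj, if_neg hi, if_neg hj, one_mul]

end Subst

/-! ### §2 The reflection as a `ℂ`-automorphism of `X_ψ`, and its action on complex points -/

section Iso

variable (ψ : ℂ) {i j : Fin 6} (hij : i ≠ j) {ζ : ℂ} (hζ : ζ ^ 6 = 1)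

include hζ in
/-- `ζ ≠ 0`. [folklore] -/
private theorem zeta_ne_zero : ζ ≠ 0 := by
  rintro rfl
  norm_num at hζ

/-- **The reflection `s_(i,j,ζ)` as a `ℂ`-automorphism `X_ψ ≅ X_ψ`** (restriction of the projective
linear transformation `substMap` of `ℙ⁵` to the reduced hypersurface, `SmoothHypersurface.substLiftIso`;
Bini–Garbagnati §3: `𝔖₆ ⋊ H₄ ⊆ Aut(X_ψ)`). [cite: BiniGarbagnati2012, §3.4] [cite: Hartshorne1977, II 7.1.1] -/
def reflIso : fibre ψ ≅ fibre ψ :=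
  Motives.SmoothHypersurface.substLiftIso (form ψ) (reflSubst i j ζ) (isHomogeneous_reflSubst i j ζ)
    (reflSubst i j ζ) (isHomogeneous_reflSubst i j ζ)
    (aeval_reflSubst_reflSubst hij (zeta_ne_zero hζ)) (aeval_reflSubst_form ψ hζ)
    (aeval_reflSubst_reflSubst hij (zeta_ne_zero hζ)) (aeval_reflSubst_form ψ hζ)

/-- `reflIso` is the restriction of `substMap (reflSubst i j ζ)`: `s ≫ ι = ι ≫ substMap`.
[cite: Hartshorne1977, II Ex. 3.11] -/
theorem reflIso_hom_comp_hypersurfaceι :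
    (reflIso ψ hij hζ).hom ≫ Motives.SmoothHypersurface.hypersurfaceι (form ψ) =
      Motives.SmoothHypersurface.hypersurfaceι (form ψ) ≫
        ProjectiveSpace.substMap (reflSubst i j ζ) (isHomogeneous_reflSubst i j ζ) (reflSubst i j ζ)
          (isHomogeneous_reflSubst i j ζ) (aeval_reflSubst_reflSubst hij (zeta_ne_zero hζ)) :=
  Motives.SmoothHypersurface.substLift_comp_hypersurfaceι _ _ _ _ _ _ (aeval_reflSubst_form ψ hζ)

/-- **`s_(i,j,ζ)` is an involution of `X_ψ`**: `s ≫ s = 𝟙`. [cite: BiniGarbagnati2012, §3.4] -/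
theorem reflIso_hom_comp_reflIso_hom :
    (reflIso ψ hij hζ).hom ≫ (reflIso ψ hij hζ).hom = 𝟙 (fibre ψ) :=
  Motives.SmoothHypersurface.substLift_comp_substLift (form ψ) (reflSubst i j ζ)
    (isHomogeneous_reflSubst i j ζ) (reflSubst i j ζ) (isHomogeneous_reflSubst i j ζ)
    (aeval_reflSubst_reflSubst hij (zeta_ne_zero hζ)) (aeval_reflSubst_form ψ hζ)
    (aeval_reflSubst_reflSubst hij (zeta_ne_zero hζ)) (aeval_reflSubst_form ψ hζ)

/-- **`s_(i,j,ζ)` acts on complex points by the reflection of homogeneous coordinates**: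
`rep (pt (s x)) = t • (k ↦ ζ x_j | ζ⁻¹ x_i | x_k)` for some `t ≠ 0` — the `IsRefl i j ζ` clause of
the route's cruxes, realised by a SCHEME automorphism. [cite: BiniGarbagnati2012, §3.4] -/
theorem exists_rep_pt_reflIso (x : Motives.ComplexPoints (fibre ψ)) :
    ∃ t : ℂ, t ≠ 0 ∧ (pt ψ (Motives.AlgPoints.map (reflIso ψ hij hζ).hom x)).rep =
      t • (fun k => if k = i then ζ * (pt ψ x).rep j else if k = j then ζ⁻¹ * (pt ψ x).rep i
        else (pt ψ x).rep k) := by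
  obtain ⟨t, ht, h⟩ := exists_rep_hypersurfacePoint_map_of_comp_eq (reflSubst i j ζ)
    (isHomogeneous_reflSubst i j ζ) (reflSubst i j ζ) (isHomogeneous_reflSubst i j ζ)
    (aeval_reflSubst_reflSubst hij (zeta_ne_zero hζ))
    (Motives.SmoothHypersurface.hypersurfaceι (form ψ)) (reflIso ψ hij hζ).hom
    (reflIso_hom_comp_hypersurfaceι ψ hij hζ) x
  exact ⟨t, ht, h.trans (by rw [substVec_reflSubst hij])⟩

/-- **Uniqueness of the realising map**: two continuous self-maps of `X_ψ(ℂ)` acting as the same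
reflection on homogeneous coordinates are equal (`pt ψ` is injective). [cite: Katz2009, §3] -/
theorem refl_unique {g g' : C(Motives.ComplexPoints (fibre ψ), Motives.ComplexPoints (fibre ψ))}
    (hg : ∀ x, ∃ t : ℂ, (pt ψ (g x)).rep = t • (fun k => if k = i then ζ * (pt ψ x).rep j
      else if k = j then ζ⁻¹ * (pt ψ x).rep i else (pt ψ x).rep k))
    (hg' : ∀ x, ∃ t : ℂ, (pt ψ (g' x)).rep = t • (fun k => if k = i then ζ * (pt ψ x).rep j
      else if k = j then ζ⁻¹ * (pt ψ x).rep i else (pt ψ x).rep k)) : g = g' := by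
  have hinj := (isEmbedding_hypersurfacePoint
    (Motives.SmoothHypersurface.hypersurfaceι (form ψ))).injective
  refine ContinuousMap.ext fun x => hinj ?_
  obtain ⟨t, ht⟩ := hg x
  obtain ⟨t', ht'⟩ := hg' x
  have ht'0 : t' ≠ 0 := by
    rintro rfl
    exact (pt ψ (g' x)).rep_nonzero (by rw [ht', zero_smul])
  have key : Projectivization.mk ℂ (pt ψ (g x)).rep (Projectivization.rep_nonzero _) =
      Projectivization.mk ℂ (pt ψ (g' x)).rep (Projectivization.rep_nonzero _) :=
    (Projectivization.mk_eq_mk_iff' ℂ _ _ _ _).2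
      ⟨t / t', by rw [ht, ht', smul_smul, div_mul_cancel₀ t ht'0]⟩
  simpa only [Projectivization.mk_rep] using key

/-- **The order-two group `⟨s_(i,j,ζ)⟩` acting on `X_ψ` over `ℂ`** (an `ActionOver (fibre ψ).hom`
of `ℤ/2`, via `ActionOver.ofInvolution`). [cite: BiniGarbagnati2012, §3.4] -/
def reflAction : ActionOver (fibre ψ).hom (Multiplicative (ZMod 2)) :=
  ActionOver.ofInvolution (reflIso ψ hij hζ) (reflIso_hom_comp_reflIso_hom ψ hij hζ)

/-- The non-trivial element acts by `s_(i,j,ζ)`. [cite: BiniGarbagnati2012, §3.4] -/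
theorem overIso_reflAction_hom_of_ne_one {g : Multiplicative (ZMod 2)} (hg : g ≠ 1) :
    ((reflAction ψ hij hζ).overIso g).hom = (reflIso ψ hij hζ).hom :=
  ActionOver.overIso_ofInvolution_hom_of_ne_one _ _ hg

/-- **The action of `⟨s⟩` on `X_ψ(ℂ)` realises the reflection**: for the non-trivial `g`,
`pointsAction (reflAction ψ …) g` acts on homogeneous coordinates as `s_(i,j,ζ)`. [cite: BiniGarbagnati2012, §3.4] -/
theorem exists_rep_pt_pointsAction_reflAction {g : Multiplicative (ZMod 2)} (hg : g ≠ 1)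
    (x : Motives.ComplexPoints (fibre ψ)) :
    ∃ t : ℂ, (pt ψ (Motives.pointsAction (reflAction ψ hij hζ) g x)).rep =
      t • (fun k => if k = i then ζ * (pt ψ x).rep j else if k = j then ζ⁻¹ * (pt ψ x).rep i
        else (pt ψ x).rep k) := by
  obtain ⟨t, -, h⟩ := exists_rep_pt_reflIso ψ hij hζ x
  refine ⟨t, ?_⟩
  rw [Motives.pointsAction_apply, overIso_reflAction_hom_of_ne_one ψ hij hζ hg]
  exact h

/-- **Every continuous realisation of `s_(i,j,ζ)` on `X_ψ(ℂ)` is the algebraic one**: a continuous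
self-map `g'` of `X_ψ(ℂ)` with the `IsRefl i j ζ` property equals `pointsAction (reflAction ψ …) g`
for the non-trivial `g ∈ ℤ/2`. Hence «`g'^* c = c`» in the route's cruxes is invariance of `c` under
the scheme-theoretic group `⟨s⟩`. [cite: BiniGarbagnati2012, §3.4] -/
theorem eq_pointsAction_of_isRefl {g' : C(Motives.ComplexPoints (fibre ψ), Motives.ComplexPoints (fibre ψ))}
    (hg' : ∀ x, ∃ t : ℂ, (pt ψ (g' x)).rep = t • (fun k => if k = i then ζ * (pt ψ x).rep j
      else if k = j then ζ⁻¹ * (pt ψ x).rep i else (pt ψ x).rep k))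
    {g : Multiplicative (ZMod 2)} (hg : g ≠ 1) :
    g' = Motives.pointsAction (reflAction ψ hij hζ) g :=
  refl_unique ψ hg' (exists_rep_pt_pointsAction_reflAction ψ hij hζ hg)

/-- Invariance under the whole group `⟨s⟩` on cohomology is invariance under the one reflection
(the trivial element acts trivially). [cite: BiniGarbagnati2012, §3.4] -/
theorem forall_map_pointsAction_eq_iff {k : ℕ} (c : complexBetti (fibre ψ) k)
    {g₀ : Multiplicative (ZMod 2)} (hg₀ : g₀ ≠ 1) :
    (∀ g : Multiplicative (ZMod 2), Literature.AlgebraicTopology.SingularHomology.singularCohomology.map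
        ℂ ℂ (Motives.pointsAction (reflAction ψ hij hζ) g) k c = c) ↔
      Literature.AlgebraicTopology.SingularHomology.singularCohomology.map ℂ ℂ
        (Motives.pointsAction (reflAction ψ hij hζ) g₀) k c = c := by
  refine ⟨fun h => h g₀, fun h g => ?_⟩
  by_cases hg : g = 1
  · subst hg
    rw [Motives.pointsAction_one]
    change (Literature.AlgebraicTopology.SingularHomology.singularCohomology.map ℂ ℂ
      (ContinuousMap.id _) k) c = c
    rw [Literature.AlgebraicTopology.SingularHomology.singularCohomology.map_id]
    rfl
  · have e : Motives.pointsAction (reflAction ψ hij hζ) g = Motives.pointsAction (reflAction ψ hij hζ) g₀ :=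
      refl_unique ψ (exists_rep_pt_pointsAction_reflAction ψ hij hζ hg)
        (exists_rep_pt_pointsAction_reflAction ψ hij hζ hg₀)
    rw [e, h]

end Iso

/-! ### §3 The quotient fourfold `X_ψ/⟨s_(i,j,ζ)⟩` -/

section Quotient

variable (ψ : ℂ) {i j : Fin 6} (hij : i ≠ j) {ζ : ℂ} (hζ : ζ ^ 6 = 1)

/-- `X_ψ → Spec ℂ` is proper (projective hypersurface), in particular separated. [cite: Hartshorne1977, II Thm. 4.9] -/
theorem isProper_fibre_hom : IsProper (fibre ψ).hom :=
  (Motives.SmoothHypersurface.isProjectiveOver_hypersurface (form ψ)).isProper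

/-- `X_ψ → Spec ℂ` is separated. [cite: Hartshorne1977, II Thm. 4.9] -/
theorem isSeparated_fibre_hom : IsSeparated (fibre ψ).hom :=
  haveI := isProper_fibre_hom ψ
  inferInstance

/-- **Mumford's covering hypothesis for `⟨s⟩` on `X_ψ`**: every point lies in an `⟨s⟩`-stable affine
open (`X_ψ` is projective). [cite: MumfordAV1970, §7 Thm. p. 66] -/
theorem reflCover : ∀ x : (fibre ψ).left, ∃ O : (reflAction ψ hij hζ).StableAffineOpens, x ∈ O.1 :=
  ActionOver.forall_exists_stableAffineOpen_of_isProjectiveOver _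
    (Motives.SmoothHypersurface.isProjectiveOver_hypersurface (form ψ))

/-- **The quotient `X_ψ/⟨s_(i,j,ζ)⟩` as a `ℂ`-scheme** (`Motives.finiteQuotient` of the order-two
action; Bini–Garbagnati's `Z := X/⟨τ⟩`). [cite: BiniGarbagnati2012, Prop. 3.20] -/
def reflQuotient : Motives.SchemeOver ℂ :=
  haveI := isSeparated_fibre_hom ψ
  Motives.finiteQuotient (reflAction ψ hij hζ)

/-- `reflQuotient` is `finiteQuotient (reflAction …)` (unfolding). [cite: BiniGarbagnati2012, Prop. 3.20] -/
theorem reflQuotient_eq :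
    reflQuotient ψ hij hζ =
      (haveI := isSeparated_fibre_hom ψ; Motives.finiteQuotient (reflAction ψ hij hζ)) := rfl

/-- **The quotient map `p : X_ψ → X_ψ/⟨s⟩`** (Bini–Garbagnati's degree-two map `p`).
[cite: BiniGarbagnati2012, Prop. 3.20] -/
def reflQuotientMap : fibre ψ ⟶ reflQuotient ψ hij hζ :=
  haveI := isSeparated_fibre_hom ψ
  Motives.finiteQuotient.mk (reflAction ψ hij hζ) (reflCover ψ hij hζ)

/-- `reflQuotientMap` is `finiteQuotient.mk` (unfolding). [cite: BiniGarbagnati2012, Prop. 3.20] -/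
theorem reflQuotientMap_eq :
    reflQuotientMap ψ hij hζ =
      (haveI := isSeparated_fibre_hom ψ
       Motives.finiteQuotient.mk (reflAction ψ hij hζ) (reflCover ψ hij hζ)) := rfl

end Quotient

/-! ### §4 Bini–Garbagnati, Prop. 3.20: the quotient is a smooth Fano — hence rationally
connected — fourfold (named fact) -/

section Fact

/-- **Bini–Garbagnati 2012, Prop. 3.20 (with Kollár–Miyaoka–Mori 1992): for `ψ⁶ ≠ 1` the quotient
`X_ψ/⟨s_(i,j,ζ)⟩` of the Dwork sextic fourfold by a coordinate reflection is a smooth projective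
fourfold which is rationally chain connected.** Verbatim (arXiv:1207.7175 p. 17, for
`X_λ^{n+1} : Σ x_l^{n+1} − (n+1)λ ∏ x_l = 0 ⊂ ℙⁿ` and `τ = (12)`): "If `n+1` is even, the fixed locus
of `τ` is the divisor `X_λ^{n+1} ∩ {x_1 = x_2}` …; the quotient `X_λ^{n+1}/⟨τ⟩` is a smooth variety.
… **Proposition 3.20.** If `n+1` is even, the quotient `Z := X_λ^{n+1}/⟨τ⟩` is a smooth Fano variety.
Moreover, it is a degree `(n+1)/2` covering of `ℙ^{n−1}`, where the ramification divisor `R` is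
linearly equivalent to `(1−n)K_Z`" (proof: `p^*(−K_Z) = h` by Riemann–Hurwitz for the double cover
`p : X → Z` ramified along the smooth divisor `X ∩ {x_1 = x_2}`, so `−K_Z` is ample). Here
`n + 1 = 6`, `λ = ψ` (the form `DworkSextic.form ψ = Σ x_l⁶ − 6ψ ∏ x_l` is Bini–Garbagnati's
`F_λ^6`), `ψ⁶ ≠ 1` (the standing smoothness assumption of §3: Prop. 2.1 (i) / Remark 2.2 "For
`λ^{n+1} ≠ 1` the varieties `X_λ^{n+1}` are smooth hypersurfaces", the double cover `p` being
"ramified over the [smooth] hypersurface `X ∩ {x_1 = x_2}`"; Katz Lemma 2.1 /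
`isSmoothProjective_fibre` in the tree). Bini–Garbagnati
state it for `τ = (12)` ("We may assume that `τ` is the transposition `(12)`", §3.4): the general
coordinate reflection `s_(i,j,ζ)` (`ζ⁶ = 1`) is conjugate to `τ_(ij)` in `Aut(X_ψ)` by the diagonal
automorphism `diag(ζ at i, ζ⁻¹ at some k ∉ {i, j})` (`DworkSextic.diagIso`, an element of Katz's
`Γ_W`) and `τ_(ij)` to `(12)` by a coordinate permutation, so all quotients `X_ψ/⟨s_(i,j,ζ)⟩` are
isomorphic to `Z`; the fact is stated for all of them. "Fano" (anticanonical class ample) is not a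
notion of the tree's `SchemeOver`; what is recorded is its consequence used downstream: a smooth Fano
variety over `ℂ` is rationally (chain) connected (Kollár–Miyaoka–Mori 1992, Thm. 0.1; Campana 1992),
in the tree's sense `Motives.IsRationallyChainConnected` (Kollár 1995, Def. 4.10), whence
`CH₀ = ℤ` / `HasChowZeroSupportedInDimLE _ 0` (`IsRationallyChainConnected.hasChowZeroSupportedInDimLE_zero`).
Smoothness and projectivity are recorded as `Motives.IsSmoothProjective 4` of the quotient.
[cite: BiniGarbagnati2012, Prop. 3.20 (arXiv p. 17) and §3.4] [cite: KollarMiyaokaMori1992, Thm. 0.1] -/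
def BiniGarbagnati2012_reflectionQuotient_smoothProjective_rcc : Prop :=
  ∀ (ψ : ℂ), ψ ^ 6 ≠ 1 → ∀ (i j : Fin 6) (hij : i ≠ j) (ζ : ℂ) (hζ : ζ ^ 6 = 1),
    Motives.IsSmoothProjective 4 (reflQuotient ψ hij hζ) ∧
      Motives.IsRationallyChainConnected (reflQuotient ψ hij hζ)

variable {ψ : ℂ} (hψ : ψ ^ 6 ≠ 1) {i j : Fin 6} (hij : i ≠ j) {ζ : ℂ} (hζ : ζ ^ 6 = 1)

include hψ in
/-- Unpacking: the quotient is a smooth projective fourfold. [cite: BiniGarbagnati2012, Prop. 3.20] -/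
theorem BiniGarbagnati2012_reflectionQuotient_smoothProjective_rcc.isSmoothProjective
    (h : BiniGarbagnati2012_reflectionQuotient_smoothProjective_rcc) :
    Motives.IsSmoothProjective 4 (reflQuotient ψ hij hζ) :=
  (h ψ hψ i j hij ζ hζ).1

include hψ in
/-- Unpacking: the quotient is rationally chain connected. [cite: KollarMiyaokaMori1992, Thm. 0.1] -/
theorem BiniGarbagnati2012_reflectionQuotient_smoothProjective_rcc.isRationallyChainConnected
    (h : BiniGarbagnati2012_reflectionQuotient_smoothProjective_rcc) :
    Motives.IsRationallyChainConnected (reflQuotient ψ hij hζ) :=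
  (h ψ hψ i j hij ζ hζ).2

include hψ in
/-- **Consequence for the route: `CH₀(X_ψ/⟨s⟩)` is supported in dimension `0`** — the hypothesis of
the tree's `hodgeConjectureFor_four_of_hasChowZeroSupportedInDimLE` with `d = 0` (rationally chain
connected smooth projective complex varieties have `CH₀ = ℤ`,
`IsRationallyChainConnected.hasChowZeroSupportedInDimLE_zero`). [cite: BiniGarbagnati2012, Prop. 3.20]
[cite: KollarMiyaokaMori1992, Thm. 0.1] -/
theorem BiniGarbagnati2012_reflectionQuotient_smoothProjective_rcc.hasChowZeroSupportedInDimLE_zero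
    (h : BiniGarbagnati2012_reflectionQuotient_smoothProjective_rcc) :
    Literature.Barriers.HodgeConjecture.HasChowZeroSupportedInDimLE (reflQuotient ψ hij hζ) 0 :=
  (h ψ hψ i j hij ζ hζ).2.hasChowZeroSupportedInDimLE_zero (h ψ hψ i j hij ζ hζ).1

end Fact

/-! ### §5 Consequences, granted the named facts: the reflections are realised, invariant classes
descend to `X_ψ/⟨s⟩`, the Hodge conjecture holds for `X_ψ/⟨s⟩`, and reflection-invariant rational
`(2,2)`-classes on `X_ψ` are algebraic -/

section Descent

open Literature.AlgebraicTopology.SingularHomology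

variable (ψ : ℂ) {i j : Fin 6} {ζ : ℂ}

/-- **The 90 reflections are realised** (for every `ψ`): there is a continuous self-map of `X_ψ(ℂ)`
acting on homogeneous coordinates as `s_(i,j,ζ)` — namely the action of the non-trivial element of
`⟨s⟩` (`pointsAction (reflAction ψ …)`), i.e. the complex points of the SCHEME automorphism `reflIso`.
[cite: BiniGarbagnati2012, §3.4] -/
theorem exists_continuousMap_isRefl (hij : i ≠ j) (hζ : ζ ^ 6 = 1) :
    ∃ g : C(Motives.ComplexPoints (fibre ψ), Motives.ComplexPoints (fibre ψ)),
      ∀ x, ∃ t : ℂ, (pt ψ (g x)).rep = t • (fun k => if k = i then ζ * (pt ψ x).rep j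
        else if k = j then ζ⁻¹ * (pt ψ x).rep i else (pt ψ x).rep k) :=
  ⟨Motives.pointsAction (reflAction ψ hij hζ) (Multiplicative.ofAdd 1),
    exists_rep_pt_pointsAction_reflAction ψ hij hζ ActionOver.gen_ne_one⟩

variable {ψ} (hψ : ψ ^ 6 ≠ 1) (hij : i ≠ j) (hζ : ζ ^ 6 = 1)

include hψ in
/-- **The Hodge conjecture holds for the quotient fourfold `X_ψ/⟨s_(i,j,ζ)⟩`** (`ψ⁶ ≠ 1`), granted
Bini–Garbagnati Prop. 3.20: a smooth projective rationally chain connected fourfold has `CH₀`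
supported in dimension `0` (`IsRationallyChainConnected.hasChowZeroSupportedInDimLE_zero`), hence
satisfies the Hodge conjecture in every degree (the tree's
`hodgeConjectureFor_four_of_hasChowZeroSupportedInDimLE`, Bloch–Srinivas 1983 Thm. 1 (3) in
codimension 2, Lefschetz (1,1), hard Lefschetz). [cite: BiniGarbagnati2012, Prop. 3.20]
[cite: BlochSrinivas1983, Thm. 1 (3)] -/
theorem hodgeConjectureFor_reflQuotient (h : BiniGarbagnati2012_reflectionQuotient_smoothProjective_rcc) :
    HodgeConjectureFor 4 (reflQuotient ψ hij hζ) :=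
  hodgeConjectureFor_four_of_hasChowZeroSupportedInDimLE (h.isSmoothProjective hψ hij hζ) (Nat.zero_le 3)
    (h.hasChowZeroSupportedInDimLE_zero hψ hij hζ)

include hψ in
/-- **Descent of reflection-invariant classes to the quotient** (`ψ⁶ ≠ 1`), granted the transfer
fact (Bredon II.19.2) and Bini–Garbagnati Prop. 3.20: if `g` is ANY continuous self-map of `X_ψ(ℂ)`
realising `s_(i,j,ζ)` on homogeneous coordinates and `c ∈ Hᵏ(X_ψ(ℂ); ℂ)` is a rational class of type
`(p, q)` with `g^* c = c`, then `c = p^* d` for a rational class `d` of type `(p, q)` on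
`X_ψ/⟨s⟩` (`g` IS the group action, `eq_pointsAction_of_isRefl`; invariance under `⟨s⟩`,
`forall_map_pointsAction_eq_iff`; then `Motives.exists_rational_hodge_map_mk_eq`).
[cite: Bredon1997, II Thm. 19.2] [cite: BiniGarbagnati2012, Prop. 3.20] -/
theorem exists_rational_hodge_map_reflQuotientMap_eq (hB : bredon1997_quotient_cohomology_invariants)
    (h : BiniGarbagnati2012_reflectionQuotient_smoothProjective_rcc)
    {g : C(Motives.ComplexPoints (fibre ψ), Motives.ComplexPoints (fibre ψ))}
    (hg : ∀ x, ∃ t : ℂ, (pt ψ (g x)).rep = t • (fun k => if k = i then ζ * (pt ψ x).rep j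
      else if k = j then ζ⁻¹ * (pt ψ x).rep i else (pt ψ x).rep k))
    {k p q : ℕ} (hpq : p + q = k) {c : complexBetti (fibre ψ) k} (hcr : IsRationalClass c)
    (hct : IsOfHodgeType 4 (fibre ψ) k p q c) (hc : singularCohomology.map ℂ ℂ g k c = c) :
    ∃ d : complexBetti (reflQuotient ψ hij hζ) k, IsRationalClass d ∧
      IsOfHodgeType 4 (reflQuotient ψ hij hζ) k p q d ∧
        complexBetti.map (reflQuotientMap ψ hij hζ) k d = c := by
  haveI := isProper_fibre_hom ψ
  haveI := isSeparated_fibre_hom ψ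
  have hinv : ∀ g₀ : Multiplicative (ZMod 2),
      singularCohomology.map ℂ ℂ (Motives.pointsAction (reflAction ψ hij hζ) g₀) k c = c := by
    refine (forall_map_pointsAction_eq_iff ψ hij hζ c ActionOver.gen_ne_one).2 ?_
    rw [← eq_pointsAction_of_isRefl ψ hij hζ hg ActionOver.gen_ne_one]
    exact hc
  exact Motives.exists_rational_hodge_map_mk_eq (reflAction ψ hij hζ) (reflCover ψ hij hζ) hB
    (isSmoothProjective_fibre hψ) (h.isSmoothProjective hψ hij hζ) hpq hcr hct hinv

include hψ hij hζ in
/-- **Reflection-invariant rational `(2,2)`-classes on the Dwork sextic are algebraic** (`ψ⁶ ≠ 1`),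
granted the three named facts: the transfer (Bredon II.19.2), Bini–Garbagnati Prop. 3.20, and the
pull-back of algebraic classes along morphisms of smooth projective varieties (Fulton Cor. 19.2 (b)).
Proof: `c = p^* d` with `d` rational of type `(2,2)` on `Z = X_ψ/⟨s⟩`
(`exists_rational_hodge_map_reflQuotientMap_eq`); `d` is algebraic on `Z` by the Hodge conjecture for
`Z` (`hodgeConjectureFor_reflQuotient`: `Z` is a smooth projective rationally chain connected
fourfold); `p^* d` is algebraic on `X_ψ` (Fulton). [cite: BiniGarbagnati2012, Prop. 3.20]
[cite: Bredon1997, II Thm. 19.2] [cite: Fulton1998, §19.2 Cor. 19.2 (b)] [cite: BlochSrinivas1983, Thm. 1 (3)] -/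
theorem mem_algebraicClasses_of_isRefl_invariant (hB : bredon1997_quotient_cohomology_invariants)
    (h : BiniGarbagnati2012_reflectionQuotient_smoothProjective_rcc)
    (hF : fulton1998_map_mem_algebraicClasses)
    {g : C(Motives.ComplexPoints (fibre ψ), Motives.ComplexPoints (fibre ψ))}
    (hg : ∀ x, ∃ t : ℂ, (pt ψ (g x)).rep = t • (fun k => if k = i then ζ * (pt ψ x).rep j
      else if k = j then ζ⁻¹ * (pt ψ x).rep i else (pt ψ x).rep k))
    {c : complexBetti (fibre ψ) (2 * 2)} (hcr : IsRationalClass c)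
    (hct : IsOfHodgeType 4 (fibre ψ) (2 * 2) 2 2 c) (hc : singularCohomology.map ℂ ℂ g (2 * 2) c = c) :
    c ∈ algebraicClasses (fibre ψ) 2 := by
  obtain ⟨d, hdr, hdt, rfl⟩ :=
    exists_rational_hodge_map_reflQuotientMap_eq hψ hij hζ hB h hg rfl hcr hct hc
  have hd : d ∈ algebraicClasses (reflQuotient ψ hij hζ) 2 :=
    (hodgeConjectureFor_reflQuotient hψ hij hζ h).2 2 d hdr hdt
  exact hF (reflQuotientMap ψ hij hζ) (h.isSmoothProjective hψ hij hζ) (isSmoothProjective_fibre hψ) 2 d hd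

end Descent

end Literature.AlgebraicGeometry.HodgeTheory.DworkSextic

end
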